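import Mathlib
import Literature.NumberTheory.Transcendental.KZCalculusProofs
import Literature.NumberTheory.Transcendental.SemialgebraicMapsProofs
import Literature.NumberTheory.Transcendental.KZSemialgebraicComplex
import Literature.NumberTheory.Transcendental.KZLogCalculusProofs
import Literature.NumberTheory.Transcendental.KZDominatedFamilyRelations
import Literature.NumberTheory.Transcendental.KZSemiCanonicalReductionProofs
import HarnessLib

/-!
# `OffTetraSectorKernel`, line `deform-to-the-oracle`: the dissections (stub `stub_dissect`)

Stub `stub_dissect` of the crux `OffTetraSectorKernel` (stmt-KontsevichZagierPeriods-10557, route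
HyperbolicBloch): the bookkeeper of the Catalan calibration. Coordinates on `ℝ²`: `x 0 = s`,
`x 1 = y`, always `0 < s < 1`; the band integrand is `g(s, y) = 1/((1 + s²) y)`. Six clauses:

* (i) the open unit square and the half-closed square `(0,1] × (0,1)` carry KZ-equivalent Catalan
  representations `1/(1 + x₀² x₁²)` (the extra edge `{x₀ = 1}` is a null coordinate line; a
  representation on the half-closed square is written down directly: the integrand is a quotient of
  `ℚ`-polynomials with denominator `≥ 1`, continuous on the compact unit cube);
* (ii) `B = M ∪ A`, (iii) `M = N ∪ T₁`, (iv) `T' = T₁ ∪ P`, (v) `P = A ∪ A*`, with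
  `B = {1 − s < y ≤ 1 + s}`, `M = {1 − s < y ≤ 1}`, `A = {1 < y ≤ 1 + s}`,
  `N = {1 − s < y ≤ 1 − s²}`, `T₁ = {1 − s² < y ≤ 1}`, `P = {1 < y ≤ 2}`, `A* = {1 + s < y ≤ 2}`,
  `T' = {1 − s² < y ≤ 2}`: each is ONE instance of Kontsevich–Zagier's rule (1a)
  `KZ.domainAddRel` with an EXACT union of two DISJOINT pieces (for `0 < s < 1`:
  `1 − s < 1 − s² < 1 < 1 + s < 2`), the pieces being restrictions (`KZ.IntegralRep.restrict`)
  of the given representation to `ℚ`-semialgebraic cells;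
* (vi) the half-closed square `[0,1) × (0,1)` and the open square carry KZ-equivalent
  shadow-square representations `1/(2 − x₀(1 + x₁²))` (null edge `{x₀ = 0}`; the open piece is
  a restriction).

The two null edges are handled by the tree's `KZ.of_sub_of_mem_relations_of_null` (two
representations whose domains differ by null sets and whose integrands agree on the overlap differ
by a relation — itself rule (1a) plus "null domains are relations"); coordinate lines are null by
`MeasureTheory.Measure.pi_hyperplane`.

References: M. Kontsevich, D. Zagier, *Periods* (2001), §1.2 rule (1); J. Bochnak, M. Coste,
M.-F. Roy, *Real Algebraic Geometry* (1998), §2.1.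
-/

noncomputable section

open Set MeasureTheory MvPolynomial
open Literature.NumberTheory.Transcendental Literature.ModelTheory.ExponentialFields

namespace Summit.KontsevichZagierPeriods.HyperbolicBloch.OffTetraSectorKernel

/-! ## Generalities: one rule-(1a) instance, restrictions, null modifications -/

/-- **Rule (1a), exact disjoint form.** If `r.domain = r₁.domain ∪ r₂.domain` with
`r₁.domain`, `r₂.domain` disjoint and the three integrands agree with one function `g` on their
domains, then `[r] − [r₁] − [r₂] ∈ KZ.relations` (one element of `KZ.domainAddRel`, the overlap
being empty). [cite: KontsevichZagier2001, §1.2 rule (1)] -/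
theorem dissect_domainAdd {n : ℕ} {g : (Fin n → ℝ) → ℝ} (r r₁ r₂ : KZ.IntegralRep n)
    (hdom : r.domain = r₁.domain ∪ r₂.domain) (hdisj : ∀ x ∈ r₁.domain, x ∉ r₂.domain)
    (hr : EqOn r.integrand g r.domain) (h₁ : EqOn r₁.integrand g r₁.domain)
    (h₂ : EqOn r₂.integrand g r₂.domain) :
    KZ.of r - KZ.of r₁ - KZ.of r₂ ∈ KZ.relations := by
  refine KZ.domainAddRel_subset_relations
    ⟨n, r, r₁, r₂, hdom, ?_, fun x hx => ?_, fun x hx => ?_, rfl⟩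
  · have : r₁.domain ∩ r₂.domain = ∅ :=
      Set.eq_empty_iff_forall_notMem.mpr fun x hx => hdisj x hx.1 hx.2
    rw [this, measure_empty]
  · rw [h₁ hx, hr (hdom ▸ Or.inl hx)]
  · rw [h₂ hx, hr (hdom ▸ Or.inr hx)]

/-- Restriction of a representation with integrand `g` (on its domain) to a `ℚ`-semialgebraic
sub-domain `s` is a representation with domain `s` and integrand `g` on it
(`KZ.IntegralRep.restrict`). [cite: KontsevichZagier2001, §1.2 rule (1)] -/
theorem dissect_exists_restrict {n : ℕ} {g : (Fin n → ℝ) → ℝ} (r : KZ.IntegralRep n)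
    (hr : EqOn r.integrand g r.domain) {s : Set (Fin n → ℝ)} (hs : IsSemialgebraic ℚ s)
    (hsr : s ⊆ r.domain) :
    ∃ r' : KZ.IntegralRep n, r'.domain = s ∧ EqOn r'.integrand g r'.domain :=
  ⟨r.restrict s hs hsr, rfl, fun _ hx => hr (hsr hx)⟩

/-- **Null modification.** Two representations whose integrands agree with one function `g` on their
domains and whose domains differ by Lebesgue-null sets are KZ-equivalent
(`KZ.of_sub_of_mem_relations_of_null`). [cite: KontsevichZagier2001, §1.2 rule (1)] -/
theorem dissect_equivalent_of_null {n : ℕ} {g : (Fin n → ℝ) → ℝ} (r r' : KZ.IntegralRep n)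
    (hr : EqOn r.integrand g r.domain) (hr' : EqOn r'.integrand g r'.domain)
    (h₁ : volume (r.domain \ r'.domain) = 0) (h₂ : volume (r'.domain \ r.domain) = 0) :
    KZ.Equivalent r r' :=
  KZ.of_sub_of_mem_relations_of_null r r' h₁ h₂ fun _ hx => (hr hx.1).trans (hr' hx.2).symm

/-! ## Semialgebraic cells -/

/-- A strict inequality `u < v` between two `ℚ`-polynomial functions cuts out a `ℚ`-semialgebraic
subset of `ℝ²`. [cite: BochnakCosteRoy1998, §2.1] -/
theorem dissect_isSemialgebraic_lt {u v : (Fin 2 → ℝ) → ℝ} (p q : MvPolynomial (Fin 2) ℚ)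
    (hp : ∀ x : Fin 2 → ℝ, aeval x p = u x) (hq : ∀ x : Fin 2 → ℝ, aeval x q = v x) :
    IsSemialgebraic ℚ {x : Fin 2 → ℝ | u x < v x} := by
  have hS : {x : Fin 2 → ℝ | u x < v x} = {x : Fin 2 → ℝ | aeval x p < aeval x q} := by
    ext x
    simp [hp, hq]
  rw [hS]
  exact isSemialgebraic_setOf_eval_lt p q

/-- A non-strict inequality `u ≤ v` between two `ℚ`-polynomial functions cuts out a
`ℚ`-semialgebraic subset of `ℝ²`. [cite: BochnakCosteRoy1998, §2.1] -/
theorem dissect_isSemialgebraic_le {u v : (Fin 2 → ℝ) → ℝ} (p q : MvPolynomial (Fin 2) ℚ)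
    (hp : ∀ x : Fin 2 → ℝ, aeval x p = u x) (hq : ∀ x : Fin 2 → ℝ, aeval x q = v x) :
    IsSemialgebraic ℚ {x : Fin 2 → ℝ | u x ≤ v x} := by
  have hS : {x : Fin 2 → ℝ | u x ≤ v x} = {x : Fin 2 → ℝ | aeval x p ≤ aeval x q} := by
    ext x
    simp [hp, hq]
  rw [hS]
  exact isSemialgebraic_setOf_eval_le p q

/-- A set cut out by four `ℚ`-semialgebraic conditions is `ℚ`-semialgebraic (intersection).
[cite: BochnakCosteRoy1998, §2.1] -/
theorem dissect_isSemialgebraic_and₄ {P₁ P₂ P₃ P₄ : (Fin 2 → ℝ) → Prop}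
    (h₁ : IsSemialgebraic ℚ {x | P₁ x}) (h₂ : IsSemialgebraic ℚ {x | P₂ x})
    (h₃ : IsSemialgebraic ℚ {x | P₃ x}) (h₄ : IsSemialgebraic ℚ {x | P₄ x}) :
    IsSemialgebraic ℚ {x | P₁ x ∧ P₂ x ∧ P₃ x ∧ P₄ x} := by
  have hS : {x | P₁ x ∧ P₂ x ∧ P₃ x ∧ P₄ x} =
      {x | P₁ x} ∩ ({x | P₂ x} ∩ ({x | P₃ x} ∩ {x | P₄ x})) := by
    ext x
    simp
  rw [hS]
  exact h₁.inter (h₂.inter (h₃.inter h₄))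

/-- A cell `{0 < s < 1, u(s,y) < y ≤ v(s,y)}` with `u`, `v` given by `ℚ`-polynomials is
`ℚ`-semialgebraic. [cite: BochnakCosteRoy1998, §2.1] -/
theorem dissect_isSemialgebraic_cell {u v : (Fin 2 → ℝ) → ℝ} (p q : MvPolynomial (Fin 2) ℚ)
    (hp : ∀ x : Fin 2 → ℝ, aeval x p = u x) (hq : ∀ x : Fin 2 → ℝ, aeval x q = v x) :
    IsSemialgebraic ℚ {x : Fin 2 → ℝ | 0 < x 0 ∧ x 0 < 1 ∧ u x < x 1 ∧ x 1 ≤ v x} :=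
  dissect_isSemialgebraic_and₄ (dissect_isSemialgebraic_lt 0 (X 0) (by simp) (by simp))
    (dissect_isSemialgebraic_lt (X 0) 1 (by simp) (by simp))
    (dissect_isSemialgebraic_lt p (X 1) hp (by simp))
    (dissect_isSemialgebraic_le (X 1) q (by simp) hq)

/-- The half-closed square `(0,1] × (0,1)` is `ℚ`-semialgebraic.
[cite: BochnakCosteRoy1998, §2.1] -/
theorem dissect_isSemialgebraic_sqK :
    IsSemialgebraic ℚ {x : Fin 2 → ℝ | 0 < x 0 ∧ x 0 ≤ 1 ∧ 0 < x 1 ∧ x 1 < 1} :=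
  dissect_isSemialgebraic_and₄ (dissect_isSemialgebraic_lt 0 (X 0) (by simp) (by simp))
    (dissect_isSemialgebraic_le (X 0) 1 (by simp) (by simp))
    (dissect_isSemialgebraic_lt 0 (X 1) (by simp) (by simp))
    (dissect_isSemialgebraic_lt (X 1) 1 (by simp) (by simp))

/-! ## (i) The Catalan square: open versus half-closed (null edge `x₀ = 1`) -/

/-- The Catalan integrand `1/(1 + x₀² x₁²)` is a `ℚ`-semialgebraic function on every
`ℚ`-semialgebraic set (quotient of `ℚ`-polynomials, denominator `≥ 1`).
[cite: KontsevichZagier2001, §1.1] -/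
theorem dissect_isSemialgebraicFunOn_catalan {σ : Set (Fin 2 → ℝ)} (hσ : IsSemialgebraic ℚ σ) :
    IsSemialgebraicFunOn ℚ σ (fun x => 1 / (1 + x 0 ^ 2 * x 1 ^ 2)) := by
  refine (isSemialgebraicFunOn_aeval_div_aeval hσ 1 (1 + X 0 ^ 2 * X 1 ^ 2) fun x _ => ?_).congr
    fun x _ => by simp
  have : (0 : ℝ) < 1 + x 0 ^ 2 * x 1 ^ 2 := by positivity
  simpa using this.ne'

/-- The Catalan integrand is integrable on the half-closed square (continuous on the compact unit
cube `[0,1]²`, which contains it). [folklore] -/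
theorem dissect_integrableOn_catalan :
    IntegrableOn (fun x : Fin 2 → ℝ => 1 / (1 + x 0 ^ 2 * x 1 ^ 2))
      {x : Fin 2 → ℝ | 0 < x 0 ∧ x 0 ≤ 1 ∧ 0 < x 1 ∧ x 1 < 1} := by
  have hI : IntegrableOn (fun x : Fin 2 → ℝ => 1 / (1 + x 0 ^ 2 * x 1 ^ 2)) (Icc 0 1) := by
    refine ContinuousOn.integrableOn_compact isCompact_Icc (Continuous.continuousOn ?_)
    exact Continuous.div continuous_const (by fun_prop) fun x => by positivity
  refine hI.mono_set ?_
  rintro x ⟨h0, h1, h2, h3⟩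
  refine ⟨fun i => ?_, fun i => ?_⟩
  · fin_cases i
    · exact h0.le
    · exact h2.le
  · fin_cases i
    · exact h1
    · exact h3.le

/-- **(i) Catalan's square, open versus half-closed.** For every Catalan representation `κ` on
the open unit square: a Catalan representation on the half-closed square `(0,1] × (0,1)` exists,
and every such `K` is KZ-equivalent to `κ` (the domains differ by the null edge `{x₀ = 1}`, the
integrands agree on the open square). [cite: KontsevichZagier2001, §1.2 rule (1)] -/
theorem dissect_catalanEdge : ∀ κ : Literature.NumberTheory.Transcendental.KZ.IntegralRep 2, κ.domain = {x | 0 < x 0 ∧ x 0 < 1 ∧ 0 < x 1 ∧ x 1 < 1} → Set.EqOn κ.integrand (fun x => 1 / (1 + x 0 ^ 2 * x 1 ^ 2)) κ.domain → (∃ K : Literature.NumberTheory.Transcendental.KZ.IntegralRep 2, K.domain = {x | 0 < x 0 ∧ x 0 ≤ 1 ∧ 0 < x 1 ∧ x 1 < 1} ∧ Set.EqOn K.integrand (fun x => 1 / (1 + x 0 ^ 2 * x 1 ^ 2)) K.domain) ∧ (∀ K : Literature.NumberTheory.Transcendental.KZ.IntegralRep 2, K.domain = {x | 0 < x 0 ∧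 x 0 ≤ 1 ∧ 0 < x 1 ∧ x 1 < 1} → Set.EqOn K.integrand (fun x => 1 / (1 + x 0 ^ 2 * x 1 ^ 2)) K.domain → Literature.NumberTheory.Transcendental.KZ.Equivalent κ K) := by
  intro κ hκ hκi
  refine ⟨⟨⟨{x : Fin 2 → ℝ | 0 < x 0 ∧ x 0 ≤ 1 ∧ 0 < x 1 ∧ x 1 < 1},
    fun x => 1 / (1 + x 0 ^ 2 * x 1 ^ 2), dissect_isSemialgebraic_sqK,
    dissect_isSemialgebraicFunOn_catalan dissect_isSemialgebraic_sqK,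
    dissect_integrableOn_catalan⟩, rfl, fun _ _ => rfl⟩, fun K hK hKi => ?_⟩
  refine dissect_equivalent_of_null κ K hκi hKi ?_ ?_
  · have : κ.domain \ K.domain = ∅ := by
      rw [hκ, hK, Set.sdiff_eq_empty]
      rintro x ⟨h0, h1, h2, h3⟩
      exact ⟨h0, h1.le, h2, h3⟩
    rw [this, measure_empty]
  · -- the extra edge `{x₀ = 1}` is a null coordinate line
    have hline : volume {x : Fin 2 → ℝ | x 0 = 1} = 0 := by
      rw [volume_pi]
      exact Measure.pi_hyperplane (fun _ : Fin 2 => (volume : Measure ℝ)) (0 : Fin 2) 1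
    refine measure_mono_null ?_ hline
    rw [hκ, hK]
    rintro x ⟨⟨h0, h1, h2, h3⟩, hx⟩
    by_contra hne
    exact hx ⟨h0, lt_of_le_of_ne h1 hne, h2, h3⟩

/-! ## (ii)–(v) The four exact dissections of the band pieces -/

/-- **(ii) `B = M ∪ A`** (`B = {1 − s < y ≤ 1 + s}`, `M = {1 − s < y ≤ 1}`,
`A = {1 < y ≤ 1 + s}`, over `0 < s < 1`): the pieces exist (restrictions of `B`) and every choice
of pieces gives one rule-(1a) relation `[B] − [M] − [A]`.
[cite: KontsevichZagier2001, §1.2 rule (1)] -/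
theorem dissect_band : ∀ B : Literature.NumberTheory.Transcendental.KZ.IntegralRep 2, B.domain = {x | 0 < x 0 ∧ x 0 < 1 ∧ 1 - x 0 < x 1 ∧ x 1 ≤ 1 + x 0} → Set.EqOn B.integrand (fun x => 1 / ((1 + x 0 ^ 2) * x 1)) B.domain → (∃ M A : Literature.NumberTheory.Transcendental.KZ.IntegralRep 2, M.domain = {x | 0 < x 0 ∧ x 0 < 1 ∧ 1 - x 0 < x 1 ∧ x 1 ≤ 1} ∧ Set.EqOn M.integrand (fun x => 1 / ((1 + x 0 ^ 2) * x 1)) M.domain ∧ A.domain = {x | 0 < x 0 ∧ x 0 < 1 ∧ 1 < x 1 ∧ x 1 ≤ 1 + x 0} ∧ Set.EqOn A.integrand (fun x => 1 / ((1 + x 0 ^ 2) * x 1)) A.domain) ∧ (∀ M A : Literature.NumberTheory.Transcendental.KZ.IntegralRep 2, M.domain = {x | 0 < x 0 ∧ x 0 < 1 ∧ 1 - x 0 < x 1 ∧ x 1 ≤ 1} → Set.EqOn M.integrand (fun x => 1 / ((1 + x 0 ^ 2) * x 1)) M.domain → A.domain = {x | 0 < x 0 ∧ x 0 < 1 ∧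 1 < x 1 ∧ x 1 ≤ 1 + x 0} → Set.EqOn A.integrand (fun x => 1 / ((1 + x 0 ^ 2) * x 1)) A.domain → Literature.NumberTheory.Transcendental.KZ.of B - Literature.NumberTheory.Transcendental.KZ.of M - Literature.NumberTheory.Transcendental.KZ.of A ∈ Literature.NumberTheory.Transcendental.KZ.relations) := by
  intro B hB hBi
  refine ⟨?_, fun M A hM hMi hA hAi => ?_⟩
  · obtain ⟨M, hM, hMi⟩ := dissect_exists_restrict B hBi
      (dissect_isSemialgebraic_cell (u := fun x => 1 - x 0) (v := fun _ => 1) (1 - X 0) 1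
        (fun x => by simp) (fun x => by simp)) (by
        rw [hB]
        rintro x ⟨h0, h1, h2, h3⟩
        exact ⟨h0, h1, h2, by linarith⟩)
    obtain ⟨A, hA, hAi⟩ := dissect_exists_restrict B hBi
      (dissect_isSemialgebraic_cell (u := fun _ => 1) (v := fun x => 1 + x 0) 1 (1 + X 0)
        (fun x => by simp) (fun x => by simp)) (by
        rw [hB]
        rintro x ⟨h0, h1, h2, h3⟩
        exact ⟨h0, h1, by linarith, h3⟩)
    exact ⟨M, A, hM, hMi, hA, hAi⟩
  · refine dissect_domainAdd B M A ?_ ?_ hBi hMi hAi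
    · rw [hB, hM, hA]
      ext x
      simp only [mem_setOf_eq, mem_union]
      constructor
      · rintro ⟨h0, h1, h2, h3⟩
        rcases le_or_gt (x 1) 1 with h | h
        · exact Or.inl ⟨h0, h1, h2, h⟩
        · exact Or.inr ⟨h0, h1, h, h3⟩
      · rintro (⟨h0, h1, h2, h3⟩ | ⟨h0, h1, h2, h3⟩)
        · exact ⟨h0, h1, h2, by linarith⟩
        · exact ⟨h0, h1, by linarith, h3⟩
    · rw [hM, hA]
      rintro x ⟨-, -, -, h3⟩ ⟨-, -, h2, -⟩
      exact absurd h3 (not_le.mpr h2)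

/-- **(iii) `M = N ∪ T₁`** (`N = {1 − s < y ≤ 1 − s²}`, `T₁ = {1 − s² < y ≤ 1}`;
`1 − s < 1 − s² < 1` for `0 < s < 1`): the pieces exist (restrictions of `M`) and every choice of
pieces gives one rule-(1a) relation `[M] − [N] − [T₁]`.
[cite: KontsevichZagier2001, §1.2 rule (1)] -/
theorem dissect_M : ∀ M : Literature.NumberTheory.Transcendental.KZ.IntegralRep 2, M.domain = {x | 0 < x 0 ∧ x 0 < 1 ∧ 1 - x 0 < x 1 ∧ x 1 ≤ 1} → Set.EqOn M.integrand (fun x => 1 / ((1 + x 0 ^ 2) * x 1)) M.domain → (∃ N T₁ : Literature.NumberTheory.Transcendental.KZ.IntegralRep 2, N.domain = {x | 0 < x 0 ∧ x 0 < 1 ∧ 1 - x 0 < x 1 ∧ x 1 ≤ 1 - x 0 ^ 2} ∧ Set.EqOn N.integrand (fun x => 1 / ((1 + x 0 ^ 2) * x 1)) N.domain ∧ T₁.domain = {x | 0 < x 0 ∧ x 0 < 1 ∧ 1 - x 0 ^ 2 < x 1 ∧ x 1 ≤ 1} ∧ Set.EqOn T₁.integrand (fun x => 1 / ((1 + x 0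 ^ 2) * x 1)) T₁.domain) ∧ (∀ N T₁ : Literature.NumberTheory.Transcendental.KZ.IntegralRep 2, N.domain = {x | 0 < x 0 ∧ x 0 < 1 ∧ 1 - x 0 < x 1 ∧ x 1 ≤ 1 - x 0 ^ 2} → Set.EqOn N.integrand (fun x => 1 / ((1 + x 0 ^ 2) * x 1)) N.domain → T₁.domain = {x | 0 < x 0 ∧ x 0 < 1 ∧ 1 - x 0 ^ 2 < x 1 ∧ x 1 ≤ 1} → Set.EqOn T₁.integrand (fun x => 1 / ((1 + x 0 ^ 2) * x 1)) T₁.domain → Literature.NumberTheory.Transcendental.KZ.of M - Literature.NumberTheory.Transcendental.KZ.of N - Literature.NumberTheory.Transcendental.KZ.of T₁ ∈ Literature.NumberTheory.Transcendental.KZ.relations) := by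
  intro M hM hMi
  refine ⟨?_, fun N T₁ hN hNi hT₁ hT₁i => ?_⟩
  · obtain ⟨N, hN, hNi⟩ := dissect_exists_restrict M hMi
      (dissect_isSemialgebraic_cell (u := fun x => 1 - x 0) (v := fun x => 1 - x 0 ^ 2) (1 - X 0)
        (1 - X 0 ^ 2) (fun x => by simp) (fun x => by simp)) (by
        rw [hM]
        rintro x ⟨h0, h1, h2, h3⟩
        exact ⟨h0, h1, h2, by nlinarith⟩)
    obtain ⟨T₁, hT₁, hT₁i⟩ := dissect_exists_restrict M hMi
      (dissect_isSemialgebraic_cell (u := fun x => 1 - x 0 ^ 2) (v := fun _ => 1) (1 - X 0 ^ 2) 1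
        (fun x => by simp) (fun x => by simp)) (by
        rw [hM]
        rintro x ⟨h0, h1, h2, h3⟩
        exact ⟨h0, h1, by nlinarith, h3⟩)
    exact ⟨N, T₁, hN, hNi, hT₁, hT₁i⟩
  · refine dissect_domainAdd M N T₁ ?_ ?_ hMi hNi hT₁i
    · rw [hM, hN, hT₁]
      ext x
      simp only [mem_setOf_eq, mem_union]
      constructor
      · rintro ⟨h0, h1, h2, h3⟩
        rcases le_or_gt (x 1) (1 - x 0 ^ 2) with h | h
        · exact Or.inl ⟨h0, h1, h2, h⟩
        · exact Or.inr ⟨h0, h1, h, h3⟩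
      · rintro (⟨h0, h1, h2, h3⟩ | ⟨h0, h1, h2, h3⟩)
        · exact ⟨h0, h1, h2, by nlinarith⟩
        · exact ⟨h0, h1, by nlinarith, h3⟩
    · rw [hN, hT₁]
      rintro x ⟨-, -, -, h3⟩ ⟨-, -, h2, -⟩
      exact absurd h3 (not_le.mpr h2)

/-- **(iv) `T' = T₁ ∪ P`** (`T' = {1 − s² < y ≤ 2}`, `T₁ = {1 − s² < y ≤ 1}`,
`P = {1 < y ≤ 2}`): the pieces exist (restrictions of `T'`) and every choice of pieces gives one
rule-(1a) relation `[T'] − [T₁] − [P]`. [cite: KontsevichZagier2001, §1.2 rule (1)] -/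
theorem dissect_Tband : ∀ T' : Literature.NumberTheory.Transcendental.KZ.IntegralRep 2, T'.domain = {x | 0 < x 0 ∧ x 0 < 1 ∧ 1 - x 0 ^ 2 < x 1 ∧ x 1 ≤ 2} → Set.EqOn T'.integrand (fun x => 1 / ((1 + x 0 ^ 2) * x 1)) T'.domain → (∃ T₁ P : Literature.NumberTheory.Transcendental.KZ.IntegralRep 2, T₁.domain = {x | 0 < x 0 ∧ x 0 < 1 ∧ 1 - x 0 ^ 2 < x 1 ∧ x 1 ≤ 1} ∧ Set.EqOn T₁.integrand (fun x => 1 / ((1 + x 0 ^ 2) * x 1)) T₁.domain ∧ P.domain = {x | 0 < x 0 ∧ x 0 < 1 ∧ 1 < x 1 ∧ x 1 ≤ 2} ∧ Set.EqOn P.integrand (fun x => 1 / ((1 + x 0 ^ 2) * x 1)) P.domain) ∧ (∀ T₁ P : Literature.NumberTheory.Transcendental.KZ.IntegralRep 2, T₁.domain = {x | 0 < x 0 ∧ x 0 < 1 ∧ 1 - x 0 ^ 2 < x 1 ∧ x 1 ≤ 1} → Set.EqOn T₁.integrand (fun x => 1 / ((1 + x 0 ^ 2) * x 1)) T₁.domain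 → P.domain = {x | 0 < x 0 ∧ x 0 < 1 ∧ 1 < x 1 ∧ x 1 ≤ 2} → Set.EqOn P.integrand (fun x => 1 / ((1 + x 0 ^ 2) * x 1)) P.domain → Literature.NumberTheory.Transcendental.KZ.of T' - Literature.NumberTheory.Transcendental.KZ.of T₁ - Literature.NumberTheory.Transcendental.KZ.of P ∈ Literature.NumberTheory.Transcendental.KZ.relations) := by
  intro T' hT' hT'i
  refine ⟨?_, fun T₁ P hT₁ hT₁i hP hPi => ?_⟩
  · obtain ⟨T₁, hT₁, hT₁i⟩ := dissect_exists_restrict T' hT'i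
      (dissect_isSemialgebraic_cell (u := fun x => 1 - x 0 ^ 2) (v := fun _ => 1) (1 - X 0 ^ 2) 1
        (fun x => by simp) (fun x => by simp)) (by
        rw [hT']
        rintro x ⟨h0, h1, h2, h3⟩
        exact ⟨h0, h1, h2, by linarith⟩)
    obtain ⟨P, hP, hPi⟩ := dissect_exists_restrict T' hT'i
      (dissect_isSemialgebraic_cell (u := fun _ => 1) (v := fun _ => 2) 1 2
        (fun x => by simp) (fun x => by simp)) (by
        rw [hT']
        rintro x ⟨h0, h1, h2, h3⟩
        exact ⟨h0, h1, by nlinarith, h3⟩)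
    exact ⟨T₁, P, hT₁, hT₁i, hP, hPi⟩
  · refine dissect_domainAdd T' T₁ P ?_ ?_ hT'i hT₁i hPi
    · rw [hT', hT₁, hP]
      ext x
      simp only [mem_setOf_eq, mem_union]
      constructor
      · rintro ⟨h0, h1, h2, h3⟩
        rcases le_or_gt (x 1) 1 with h | h
        · exact Or.inl ⟨h0, h1, h2, h⟩
        · exact Or.inr ⟨h0, h1, h, h3⟩
      · rintro (⟨h0, h1, h2, h3⟩ | ⟨h0, h1, h2, h3⟩)
        · exact ⟨h0, h1, h2, by linarith⟩
        · exact ⟨h0, h1, by nlinarith, h3⟩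
    · rw [hT₁, hP]
      rintro x ⟨-, -, -, h3⟩ ⟨-, -, h2, -⟩
      exact absurd h3 (not_le.mpr h2)

/-- **(v) `P = A ∪ A*`** (`P = {1 < y ≤ 2}`, `A = {1 < y ≤ 1 + s}`, `A* = {1 + s < y ≤ 2}`):
every choice of the three representations gives one rule-(1a) relation `[P] − [A] − [A*]`.
[cite: KontsevichZagier2001, §1.2 rule (1)] -/
theorem dissect_P : ∀ P A As : Literature.NumberTheory.Transcendental.KZ.IntegralRep 2, P.domain = {x | 0 < x 0 ∧ x 0 < 1 ∧ 1 < x 1 ∧ x 1 ≤ 2} → Set.EqOn P.integrand (fun x => 1 / ((1 + x 0 ^ 2) * x 1)) P.domain → A.domain = {x | 0 < x 0 ∧ x 0 < 1 ∧ 1 < x 1 ∧ x 1 ≤ 1 + x 0} → Set.EqOn A.integrand (fun x => 1 / ((1 + x 0 ^ 2) * x 1)) A.domain → As.domain = {x | 0 < x 0 ∧ x 0 < 1 ∧ 1 + x 0 < x 1 ∧ x 1 ≤ 2} → Set.EqOn As.integrand (fun x => 1 / ((1 + x 0 ^ 2) * x 1)) As.domain → Literature.NumberTheory.Transcendental.KZ.of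 P - Literature.NumberTheory.Transcendental.KZ.of A - Literature.NumberTheory.Transcendental.KZ.of As ∈ Literature.NumberTheory.Transcendental.KZ.relations := by
  intro P A As hP hPi hA hAi hAs hAsi
  refine dissect_domainAdd P A As ?_ ?_ hPi hAi hAsi
  · rw [hP, hA, hAs]
    ext x
    simp only [mem_setOf_eq, mem_union]
    constructor
    · rintro ⟨h0, h1, h2, h3⟩
      rcases le_or_gt (x 1) (1 + x 0) with h | h
      · exact Or.inl ⟨h0, h1, h2, h⟩
      · exact Or.inr ⟨h0, h1, h, h3⟩
    · rintro (⟨h0, h1, h2, h3⟩ | ⟨h0, h1, h2, h3⟩)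
      · exact ⟨h0, h1, h2, by linarith⟩
      · exact ⟨h0, h1, by linarith, h3⟩
  · rw [hA, hAs]
    rintro x ⟨-, -, -, h3⟩ ⟨-, -, h2, -⟩
    exact absurd h3 (not_le.mpr h2)

/-! ## (vi) The shadow square: half-closed versus open (null edge `x₀ = 0`) -/

/-- **(vi) The shadow square, half-closed versus open.** For every shadow-square representation
`T` on `[0,1) × (0,1)` (integrand `1/(2 − x₀(1 + x₁²))`): a representation on the open square
exists (the restriction of `T`), and every such `T₀` is KZ-equivalent to `T` (the domains differ
by the null edge `{x₀ = 0}`). [cite: KontsevichZagier2001, §1.2 rule (1)] -/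
theorem dissect_shadowEdge : ∀ T : Literature.NumberTheory.Transcendental.KZ.IntegralRep 2, T.domain = {x | 0 ≤ x 0 ∧ x 0 < 1 ∧ 0 < x 1 ∧ x 1 < 1} → Set.EqOn T.integrand (fun x => 1 / (2 - x 0 * (1 + x 1 ^ 2))) T.domain → (∃ T₀ : Literature.NumberTheory.Transcendental.KZ.IntegralRep 2, T₀.domain = {x | 0 < x 0 ∧ x 0 < 1 ∧ 0 < x 1 ∧ x 1 < 1} ∧ Set.EqOn T₀.integrand (fun x => 1 / (2 - x 0 * (1 + x 1 ^ 2))) T₀.domain) ∧ (∀ T₀ : Literature.NumberTheory.Transcendental.KZ.IntegralRep 2, T₀.domain = {x | 0 < x 0 ∧ x 0 < 1 ∧ 0 < x 1 ∧ x 1 < 1} → Set.EqOn T₀.integrand (fun x => 1 / (2 - x 0 * (1 + x 1 ^ 2))) T₀.domain → Literature.NumberTheory.Transcendental.KZ.Equivalent T T₀) := by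
  intro T hT hTi
  refine ⟨?_, fun T₀ hT₀ hT₀i => ?_⟩
  · -- the open unit square is `ℚ`-semialgebraic, and `T` restricts to it
    have hsq : IsSemialgebraic ℚ {x : Fin 2 → ℝ | 0 < x 0 ∧ x 0 < 1 ∧ 0 < x 1 ∧ x 1 < 1} :=
      dissect_isSemialgebraic_and₄ (dissect_isSemialgebraic_lt 0 (X 0) (by simp) (by simp))
        (dissect_isSemialgebraic_lt (X 0) 1 (by simp) (by simp))
        (dissect_isSemialgebraic_lt 0 (X 1) (by simp) (by simp))
        (dissect_isSemialgebraic_lt (X 1) 1 (by simp) (by simp))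
    obtain ⟨T₀, hT₀, hT₀i⟩ := dissect_exists_restrict T hTi hsq
      (by
        rw [hT]
        rintro x ⟨h0, h1, h2, h3⟩
        exact ⟨h0.le, h1, h2, h3⟩)
    exact ⟨T₀, hT₀, hT₀i⟩
  · refine dissect_equivalent_of_null T T₀ hTi hT₀i ?_ ?_
    · -- the extra edge `{x₀ = 0}` is a null coordinate line
      have hline : volume {x : Fin 2 → ℝ | x 0 = 0} = 0 := by
        rw [volume_pi]
        exact Measure.pi_hyperplane (fun _ : Fin 2 => (volume : Measure ℝ)) (0 : Fin 2) 0
      refine measure_mono_null ?_ hline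
      rw [hT, hT₀]
      rintro x ⟨⟨h0, h1, h2, h3⟩, hx⟩
      by_contra hne
      exact hx ⟨lt_of_le_of_ne h0 (Ne.symm hne), h1, h2, h3⟩
    · have : T₀.domain \ T.domain = ∅ := by
        rw [hT, hT₀, Set.sdiff_eq_empty]
        rintro x ⟨h0, h1, h2, h3⟩
        exact ⟨h0.le, h1, h2, h3⟩
      rw [this, measure_empty]

/-! ## The stub (registered halves and the skeleton's name) -/

/-- **Registered sub-goal `stub_dissect_left`**: clauses (i)–(iii) of `stub_dissect` (Catalan null edge,
`B = M ∪ A`, `M = N ∪ T₁`). [cite: KontsevichZagier2001, §1.2 rule (1)] -/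
theorem stub_dissect_left : (∀ κ : Literature.NumberTheory.Transcendental.KZ.IntegralRep 2, κ.domain = {x | 0 < x 0 ∧ x 0 < 1 ∧ 0 < x 1 ∧ x 1 < 1} → Set.EqOn κ.integrand (fun x => 1 / (1 + x 0 ^ 2 * x 1 ^ 2)) κ.domain → (∃ K : Literature.NumberTheory.Transcendental.KZ.IntegralRep 2, K.domain = {x | 0 < x 0 ∧ x 0 ≤ 1 ∧ 0 < x 1 ∧ x 1 < 1} ∧ Set.EqOn K.integrand (fun x => 1 / (1 + x 0 ^ 2 * x 1 ^ 2)) K.domain) ∧ (∀ K : Literature.NumberTheory.Transcendental.KZ.IntegralRep 2, K.domain = {x | 0 < x 0 ∧ x 0 ≤ 1 ∧ 0 < x 1 ∧ x 1 < 1} → Set.EqOn K.integrand (fun x => 1 / (1 + x 0 ^ 2 * x 1 ^ 2)) K.domain → Literature.NumberTheory.Transcendental.KZ.Equivalent κ K)) ∧ (∀ B : Literature.NumberTheory.Transcendental.KZ.IntegralRep 2, B.domain = {x | 0 < x 0 ∧ x 0 < 1 ∧ 1 - x 0 < x 1 ∧ x 1 ≤ 1 + x 0} → Set.EqOn B.integrand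 (fun x => 1 / ((1 + x 0 ^ 2) * x 1)) B.domain → (∃ M A : Literature.NumberTheory.Transcendental.KZ.IntegralRep 2, M.domain = {x | 0 < x 0 ∧ x 0 < 1 ∧ 1 - x 0 < x 1 ∧ x 1 ≤ 1} ∧ Set.EqOn M.integrand (fun x => 1 / ((1 + x 0 ^ 2) * x 1)) M.domain ∧ A.domain = {x | 0 < x 0 ∧ x 0 < 1 ∧ 1 < x 1 ∧ x 1 ≤ 1 + x 0} ∧ Set.EqOn A.integrand (fun x => 1 / ((1 + x 0 ^ 2) * x 1)) A.domain) ∧ (∀ M A : Literature.NumberTheory.Transcendental.KZ.IntegralRep 2, M.domain = {x | 0 < x 0 ∧ x 0 < 1 ∧ 1 - x 0 < x 1 ∧ x 1 ≤ 1} → Set.EqOn M.integrand (fun x => 1 / ((1 + x 0 ^ 2) * x 1)) M.domain → A.domain = {x | 0 < x 0 ∧ x 0 < 1 ∧ 1 < x 1 ∧ x 1 ≤ 1 + x 0} → Set.EqOn A.integrand (fun x => 1 / ((1 + x 0 ^ 2) * x 1)) A.domain → Literature.NumberTheory.Transcendental.KZ.of B - Literature.NumberTheory.Transcendental.KZ.of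 M - Literature.NumberTheory.Transcendental.KZ.of A ∈ Literature.NumberTheory.Transcendental.KZ.relations)) ∧ (∀ M : Literature.NumberTheory.Transcendental.KZ.IntegralRep 2, M.domain = {x | 0 < x 0 ∧ x 0 < 1 ∧ 1 - x 0 < x 1 ∧ x 1 ≤ 1} → Set.EqOn M.integrand (fun x => 1 / ((1 + x 0 ^ 2) * x 1)) M.domain → (∃ N T₁ : Literature.NumberTheory.Transcendental.KZ.IntegralRep 2, N.domain = {x | 0 < x 0 ∧ x 0 < 1 ∧ 1 - x 0 < x 1 ∧ x 1 ≤ 1 - x 0 ^ 2} ∧ Set.EqOn N.integrand (fun x => 1 / ((1 + x 0 ^ 2) * x 1)) N.domain ∧ T₁.domain = {x | 0 < x 0 ∧ x 0 < 1 ∧ 1 - x 0 ^ 2 < x 1 ∧ x 1 ≤ 1} ∧ Set.EqOn T₁.integrand (fun x => 1 / ((1 + x 0 ^ 2) * x 1)) T₁.domain) ∧ (∀ N T₁ : Literature.NumberTheory.Transcendental.KZ.IntegralRep 2, N.domain = {x | 0 < x 0 ∧ x 0 < 1 ∧ 1 - x 0 < x 1 ∧ x 1 ≤ 1 - x 0 ^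 2} → Set.EqOn N.integrand (fun x => 1 / ((1 + x 0 ^ 2) * x 1)) N.domain → T₁.domain = {x | 0 < x 0 ∧ x 0 < 1 ∧ 1 - x 0 ^ 2 < x 1 ∧ x 1 ≤ 1} → Set.EqOn T₁.integrand (fun x => 1 / ((1 + x 0 ^ 2) * x 1)) T₁.domain → Literature.NumberTheory.Transcendental.KZ.of M - Literature.NumberTheory.Transcendental.KZ.of N - Literature.NumberTheory.Transcendental.KZ.of T₁ ∈ Literature.NumberTheory.Transcendental.KZ.relations)) :=
  ⟨dissect_catalanEdge, dissect_band, dissect_M⟩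

/-- **Registered sub-goal `stub_dissect_right`**: clauses (iv)–(vi) of `stub_dissect` (`T' = T₁ ∪ P`,
`P = A ∪ A*`, shadow-square null edge). [cite: KontsevichZagier2001, §1.2 rule (1)] -/
theorem stub_dissect_right : (∀ T' : Literature.NumberTheory.Transcendental.KZ.IntegralRep 2, T'.domain = {x | 0 < x 0 ∧ x 0 < 1 ∧ 1 - x 0 ^ 2 < x 1 ∧ x 1 ≤ 2} → Set.EqOn T'.integrand (fun x => 1 / ((1 + x 0 ^ 2) * x 1)) T'.domain → (∃ T₁ P : Literature.NumberTheory.Transcendental.KZ.IntegralRep 2, T₁.domain = {x | 0 < x 0 ∧ x 0 < 1 ∧ 1 - x 0 ^ 2 < x 1 ∧ x 1 ≤ 1} ∧ Set.EqOn T₁.integrand (fun x => 1 / ((1 + x 0 ^ 2) * x 1)) T₁.domain ∧ P.domain = {x | 0 < x 0 ∧ x 0 < 1 ∧ 1 < x 1 ∧ x 1 ≤ 2} ∧ Set.EqOn P.integrand (fun x => 1 / ((1 + x 0 ^ 2) * x 1)) P.domain) ∧ (∀ T₁ P : Literature.NumberTheory.Transcendental.KZ.IntegralRep 2, T₁.domain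 = {x | 0 < x 0 ∧ x 0 < 1 ∧ 1 - x 0 ^ 2 < x 1 ∧ x 1 ≤ 1} → Set.EqOn T₁.integrand (fun x => 1 / ((1 + x 0 ^ 2) * x 1)) T₁.domain → P.domain = {x | 0 < x 0 ∧ x 0 < 1 ∧ 1 < x 1 ∧ x 1 ≤ 2} → Set.EqOn P.integrand (fun x => 1 / ((1 + x 0 ^ 2) * x 1)) P.domain → Literature.NumberTheory.Transcendental.KZ.of T' - Literature.NumberTheory.Transcendental.KZ.of T₁ - Literature.NumberTheory.Transcendental.KZ.of P ∈ Literature.NumberTheory.Transcendental.KZ.relations)) ∧ (∀ P A As : Literature.NumberTheory.Transcendental.KZ.IntegralRep 2, P.domain = {x | 0 < x 0 ∧ x 0 < 1 ∧ 1 < x 1 ∧ x 1 ≤ 2} → Set.EqOn P.integrand (fun x => 1 / ((1 + x 0 ^ 2) * x 1)) P.domain → A.domain = {x | 0 < x 0 ∧ x 0 < 1 ∧ 1 < x 1 ∧ x 1 ≤ 1 + x 0} → Set.EqOn A.integrand (fun x => 1 / ((1 + x 0 ^ 2) * x 1)) A.domain → As.domain = {x | 0 < x 0 ∧ x 0 <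 1 ∧ 1 + x 0 < x 1 ∧ x 1 ≤ 2} → Set.EqOn As.integrand (fun x => 1 / ((1 + x 0 ^ 2) * x 1)) As.domain → Literature.NumberTheory.Transcendental.KZ.of P - Literature.NumberTheory.Transcendental.KZ.of A - Literature.NumberTheory.Transcendental.KZ.of As ∈ Literature.NumberTheory.Transcendental.KZ.relations) ∧ (∀ T : Literature.NumberTheory.Transcendental.KZ.IntegralRep 2, T.domain = {x | 0 ≤ x 0 ∧ x 0 < 1 ∧ 0 < x 1 ∧ x 1 < 1} → Set.EqOn T.integrand (fun x => 1 / (2 - x 0 * (1 + x 1 ^ 2))) T.domain → (∃ T₀ : Literature.NumberTheory.Transcendental.KZ.IntegralRep 2, T₀.domain = {x | 0 < x 0 ∧ x 0 < 1 ∧ 0 < x 1 ∧ x 1 < 1} ∧ Set.EqOn T₀.integrand (fun x => 1 / (2 - x 0 * (1 + x 1 ^ 2))) T₀.domain) ∧ (∀ T₀ : Literature.NumberTheory.Transcendental.KZ.IntegralRep 2, T₀.domain = {x | 0 < x 0 ∧ x 0 < 1 ∧ 0 < x 1 ∧ x 1 < 1} → Set.EqOn T₀.integrand (fun x => 1 /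 (2 - x 0 * (1 + x 1 ^ 2))) T₀.domain → Literature.NumberTheory.Transcendental.KZ.Equivalent T T₀)) :=
  ⟨dissect_Tband, dissect_P, dissect_shadowEdge⟩

/-- **STUB `stub_dissect`** (rule 1a and null pieces: the bookkeeper of the Catalan calibration).
Six dissections with EXACT unions, all pieces with the integrand `g(s,y) = 1/((1+s²)y)` except the
two squares: (i) the open unit square and the half-closed square `(0,1]×(0,1)` carry equivalent
Catalan representations (null edge `x₀ = 1`); (ii) `B = M ∪ A`; (iii) `M = N ∪ T₁`;
(iv) `T' = T₁ ∪ P`; (v) `P = A ∪ A*`; (vi) `[0,1)×(0,1)` versus the open square for the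
shadow-square integrand `1/(2 − a(1+s²))` (null edge `a = 0`). Existence of the pieces is by
`KZ.IntegralRep.restrict`. [cite: KontsevichZagier2001, §1.2 rule (1)] -/
theorem stub_dissect :
    (∀ κ : Literature.NumberTheory.Transcendental.KZ.IntegralRep 2, κ.domain = {x | 0 < x 0 ∧ x 0 < 1 ∧ 0 < x 1 ∧ x 1 < 1} → Set.EqOn κ.integrand (fun x => 1 / (1 + x 0 ^ 2 * x 1 ^ 2)) κ.domain → (∃ K : Literature.NumberTheory.Transcendental.KZ.IntegralRep 2, K.domain = {x | 0 < x 0 ∧ x 0 ≤ 1 ∧ 0 < x 1 ∧ x 1 < 1} ∧ Set.EqOn K.integrand (fun x => 1 / (1 + x 0 ^ 2 * x 1 ^ 2)) K.domain) ∧ (∀ K : Literature.NumberTheory.Transcendental.KZ.IntegralRep 2, K.domain = {x | 0 < x 0 ∧ x 0 ≤ 1 ∧ 0 < x 1 ∧ x 1 < 1} → Set.EqOn K.integrand (fun x => 1 / (1 + x 0 ^ 2 * x 1 ^ 2)) K.domain → Literature.NumberTheory.Transcendental.KZ.Equivalent κ K)) ∧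
    (∀ B : Literature.NumberTheory.Transcendental.KZ.IntegralRep 2, B.domain = {x | 0 < x 0 ∧ x 0 < 1 ∧ 1 - x 0 < x 1 ∧ x 1 ≤ 1 + x 0} → Set.EqOn B.integrand (fun x => 1 / ((1 + x 0 ^ 2) * x 1)) B.domain → (∃ M A : Literature.NumberTheory.Transcendental.KZ.IntegralRep 2, M.domain = {x | 0 < x 0 ∧ x 0 < 1 ∧ 1 - x 0 < x 1 ∧ x 1 ≤ 1} ∧ Set.EqOn M.integrand (fun x => 1 / ((1 + x 0 ^ 2) * x 1)) M.domain ∧ A.domain = {x | 0 < x 0 ∧ x 0 < 1 ∧ 1 < x 1 ∧ x 1 ≤ 1 + x 0} ∧ Set.EqOn A.integrand (fun x => 1 / ((1 + x 0 ^ 2) * x 1)) A.domain) ∧ (∀ M A : Literature.NumberTheory.Transcendental.KZ.IntegralRep 2, M.domain = {x | 0 < x 0 ∧ x 0 < 1 ∧ 1 - x 0 < x 1 ∧ x 1 ≤ 1} → Set.EqOn M.integrand (fun x => 1 / ((1 + x 0 ^ 2) * x 1)) M.domain → A.domain = {x | 0 < x 0 ∧ x 0 < 1 ∧ 1 < x 1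 ∧ x 1 ≤ 1 + x 0} → Set.EqOn A.integrand (fun x => 1 / ((1 + x 0 ^ 2) * x 1)) A.domain → Literature.NumberTheory.Transcendental.KZ.of B - Literature.NumberTheory.Transcendental.KZ.of M - Literature.NumberTheory.Transcendental.KZ.of A ∈ Literature.NumberTheory.Transcendental.KZ.relations)) ∧
    (∀ M : Literature.NumberTheory.Transcendental.KZ.IntegralRep 2, M.domain = {x | 0 < x 0 ∧ x 0 < 1 ∧ 1 - x 0 < x 1 ∧ x 1 ≤ 1} → Set.EqOn M.integrand (fun x => 1 / ((1 + x 0 ^ 2) * x 1)) M.domain → (∃ N T₁ : Literature.NumberTheory.Transcendental.KZ.IntegralRep 2, N.domain = {x | 0 < x 0 ∧ x 0 < 1 ∧ 1 - x 0 < x 1 ∧ x 1 ≤ 1 - x 0 ^ 2} ∧ Set.EqOn N.integrand (fun x => 1 / ((1 + x 0 ^ 2) * x 1)) N.domain ∧ T₁.domain = {x | 0 < x 0 ∧ x 0 < 1 ∧ 1 - x 0 ^ 2 < x 1 ∧ x 1 ≤ 1} ∧ Set.EqOn T₁.integrand (fun x => 1 / ((1 + x 0 ^ 2) * x 1)) T₁.domain)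 ∧ (∀ N T₁ : Literature.NumberTheory.Transcendental.KZ.IntegralRep 2, N.domain = {x | 0 < x 0 ∧ x 0 < 1 ∧ 1 - x 0 < x 1 ∧ x 1 ≤ 1 - x 0 ^ 2} → Set.EqOn N.integrand (fun x => 1 / ((1 + x 0 ^ 2) * x 1)) N.domain → T₁.domain = {x | 0 < x 0 ∧ x 0 < 1 ∧ 1 - x 0 ^ 2 < x 1 ∧ x 1 ≤ 1} → Set.EqOn T₁.integrand (fun x => 1 / ((1 + x 0 ^ 2) * x 1)) T₁.domain → Literature.NumberTheory.Transcendental.KZ.of M - Literature.NumberTheory.Transcendental.KZ.of N - Literature.NumberTheory.Transcendental.KZ.of T₁ ∈ Literature.NumberTheory.Transcendental.KZ.relations)) ∧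
    (∀ T' : Literature.NumberTheory.Transcendental.KZ.IntegralRep 2, T'.domain = {x | 0 < x 0 ∧ x 0 < 1 ∧ 1 - x 0 ^ 2 < x 1 ∧ x 1 ≤ 2} → Set.EqOn T'.integrand (fun x => 1 / ((1 + x 0 ^ 2) * x 1)) T'.domain → (∃ T₁ P : Literature.NumberTheory.Transcendental.KZ.IntegralRep 2, T₁.domain = {x | 0 < x 0 ∧ x 0 < 1 ∧ 1 - x 0 ^ 2 < x 1 ∧ x 1 ≤ 1} ∧ Set.EqOn T₁.integrand (fun x => 1 / ((1 + x 0 ^ 2) * x 1)) T₁.domain ∧ P.domain = {x | 0 < x 0 ∧ x 0 < 1 ∧ 1 < x 1 ∧ x 1 ≤ 2} ∧ Set.EqOn P.integrand (fun x => 1 / ((1 + x 0 ^ 2) * x 1)) P.domain) ∧ (∀ T₁ P : Literature.NumberTheory.Transcendental.KZ.IntegralRep 2, T₁.domain = {x | 0 < x 0 ∧ x 0 < 1 ∧ 1 - x 0 ^ 2 < x 1 ∧ x 1 ≤ 1} → Set.EqOn T₁.integrand (fun x => 1 / ((1 + x 0 ^ 2) * x 1)) T₁.domain → P.domain = {x |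 0 < x 0 ∧ x 0 < 1 ∧ 1 < x 1 ∧ x 1 ≤ 2} → Set.EqOn P.integrand (fun x => 1 / ((1 + x 0 ^ 2) * x 1)) P.domain → Literature.NumberTheory.Transcendental.KZ.of T' - Literature.NumberTheory.Transcendental.KZ.of T₁ - Literature.NumberTheory.Transcendental.KZ.of P ∈ Literature.NumberTheory.Transcendental.KZ.relations)) ∧
    (∀ P A As : Literature.NumberTheory.Transcendental.KZ.IntegralRep 2, P.domain = {x | 0 < x 0 ∧ x 0 < 1 ∧ 1 < x 1 ∧ x 1 ≤ 2} → Set.EqOn P.integrand (fun x => 1 / ((1 + x 0 ^ 2) * x 1)) P.domain → A.domain = {x | 0 < x 0 ∧ x 0 < 1 ∧ 1 < x 1 ∧ x 1 ≤ 1 + x 0} → Set.EqOn A.integrand (fun x => 1 / ((1 + x 0 ^ 2) * x 1)) A.domain → As.domain = {x | 0 < x 0 ∧ x 0 < 1 ∧ 1 + x 0 < x 1 ∧ x 1 ≤ 2} → Set.EqOn As.integrand (fun x => 1 / ((1 + x 0 ^ 2) * x 1)) As.domain → Literature.NumberTheory.Transcendental.KZ.of P - Literature.NumberTheory.Transcendental.KZ.of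 A - Literature.NumberTheory.Transcendental.KZ.of As ∈ Literature.NumberTheory.Transcendental.KZ.relations) ∧
    (∀ T : Literature.NumberTheory.Transcendental.KZ.IntegralRep 2, T.domain = {x | 0 ≤ x 0 ∧ x 0 < 1 ∧ 0 < x 1 ∧ x 1 < 1} → Set.EqOn T.integrand (fun x => 1 / (2 - x 0 * (1 + x 1 ^ 2))) T.domain → (∃ T₀ : Literature.NumberTheory.Transcendental.KZ.IntegralRep 2, T₀.domain = {x | 0 < x 0 ∧ x 0 < 1 ∧ 0 < x 1 ∧ x 1 < 1} ∧ Set.EqOn T₀.integrand (fun x => 1 / (2 - x 0 * (1 + x 1 ^ 2))) T₀.domain) ∧ (∀ T₀ : Literature.NumberTheory.Transcendental.KZ.IntegralRep 2, T₀.domain = {x | 0 < x 0 ∧ x 0 < 1 ∧ 0 < x 1 ∧ x 1 < 1} → Set.EqOn T₀.integrand (fun x => 1 / (2 - x 0 * (1 + x 1 ^ 2))) T₀.domain → Literature.NumberTheory.Transcendental.KZ.Equivalent T T₀)) :=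
  ⟨stub_dissect_left.1, stub_dissect_left.2.1, stub_dissect_left.2.2, stub_dissect_right.1,
    stub_dissect_right.2.1, stub_dissect_right.2.2⟩

end Summit.KontsevichZagierPeriods.HyperbolicBloch.OffTetraSectorKernel

end
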